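import Literature.Combinatorics.Optimization.PerfectMatchingPolytopeDimension
import Literature.Barriers.PneNP.MatchingSlackPsdFoolingSetSharp
import HarnessLib

/-!
# The exact rank of Edmonds' odd-cut slack matrix: `rank S_odd(K_n) = C(n,2) − n + 1`, attained on the triangle rows

The odd-cut slack matrix of the perfect matching polytope of `K_n`,
`S_{UM} = |δ(U) ∩ M| − 1` (rows: odd vertex sets `U`, `OddSet n`; columns: perfect matchings `M`,
`PMatch n`; the tree's `pmOddCutSlack n`, [Rothvoss2017, §2 (PDF p. 5): "`S_{UM} = |M ∩ δ(U)| − 1`"])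
is the working object of the matching-psd-rank files of this directory. The tree knew
`rank S_odd(K_n) ≤ C(n,2) + 1 − n` (`PsdFoolingSet.rank_pmOddCutSlack_le`, the `n` degree relations)
and, for the FULL slack matrix of Edmonds' description (odd-cut rows AND edge rows),
`rank S_Edmonds(K_n) = C(n,2) − n + 1 = dim P_PM(K_n) + 1`
(`PMPolytopeDim.rank_pmFullSlack`, Gouveia–Robinson–Thomas's `rank S_P = dim P + 1`
[GouveiaRobinsonThomas2013, Lemma 3.1 (p07)] with the Edmonds–Lovász–Pulleyblank matching rank
[Pulleyblank1995, Thm. 5.22 (p. 210)]), where the lower bound came from the EDGE block. Whether the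
odd-cut block alone already has this rank was left open there ("would make
`supportBasedPsdBound_le_dim` read `= rank`").

This file PROVES it does, for every even `n ≥ 6`, and that the TRIANGLE rows suffice:

* `OddCutRank.pmOddCutSlack_toOdd` — for `U = {a,b,c}`:
  `S_{UM} = 2 − 2·(χ_M(ab) + χ_M(ac) + χ_M(bc))` (a perfect matching meets a triangle in one edge or
  none; `|U| = |δ(U) ∩ M| + 2·|M ∩ E[U]|`);
* `OddCutRank.triBlock_eq_mul` — hence the triangle block `T` (rows: ordered triples of distinct
  vertices) factors as `T = G · X` with `X = (χ_M(e))_{e,M}` the edge–perfect-matching incidence matrix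
  (rank `C(n,2) − n + 1`, `PMPolytopeDim.rank_pmIncidence`) and
  `G_{(a,b,c),e} = 4/n − 2·1[e ∈ {ab, ac, bc}]` (using `|M| = n/2`, `OddCutRank.sum_pmVec`);
* `OddCutRank.triCoef_mulVec_injective` — `G` is injective on `ℝ^{E(K_n)}` for `n ≥ 5`: `Gw = 0` says
  that all triangle sums `w(ab) + w(ac) + w(bc)` equal `(2/n)·Σ_e w_e`; comparing the four triangles
  on `{a,b,c,d}` gives `w(bc) = w(ad)` for disjoint pairs (the Kneser-graph step), with a fifth vertex
  every two edges sharing a vertex are both equal to a disjoint third, so `w ≡ μ` is constant, and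
  then `3μ = (2/n)·C(n,2)·μ = (n−1)μ` forces `μ = 0`;
* `OddCutRank.rank_mul_eq_right_of_injective` — `rank (G · X) = rank X` for injective `G`
  (linear algebra, `Submodule.equivMapOfInjective`);
* **`rank_triBlock`**, **`rank_pmOddCutSlack`** — `rank T = rank S_odd(K_n) = C(n,2) − n + 1` for even
  `n ≥ 6` (`= (2m−1)(m−1)` for `n = 2m`, `rank_pmOddCutSlack_two_mul`); `rank_pmOddCutSlack_eq_rank_pmFullSlack`:
  the odd-cut block has the full rank of Edmonds' slack matrix;
* **`supportBased_window_rank`** — the support-based window of `MatchingSlackPsdFoolingSetSharp.lean`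
  restated with its right end identified as THE RANK: for `m ≥ 3` there are support-based (fooling-set)
  certificates of size `C(m+1,2) − 1` for `S_odd(K_{2m})`, none exceeds `rank S_odd(K_{2m})`
  (Lee–Theis, [FawziEtAl2015, Thm. 5.8 and §5.2 (p15)], tree `supportBased_le_rank`), and that rank is
  exactly `(2m−1)(m−1)`. So the ceiling `C(n,2) + 1 − n` of `supportBasedPsdBound_le_dim` IS `rank S`,
  and cannot be lowered by any rank computation.

Small cases: for `n = 4` the odd-cut slack matrix is identically `0` (rank `0 ≠ 3`; the theorem is
false there, whence `n ≥ 6`); `n = 6`: rank `10` (`= C(6,2) − 5`), while the psd rank is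
`rk_psd(S_odd(K_6)) = 5` exactly (kernel-checked in `MatchingSlackPsdRankSmall.lean`) — psd rank and rank
of the odd-cut block already differ at the first admissible `n`.

presearch (2026-08-29): "rank of the odd-set (blossom) block of the slack matrix of the perfect
matching polytope" → none in print (corpus `lit search --hybrid` "rank of slack matrix perfect
matching polytope odd set inequalities complete graph": Jukna 2012, Blekherman–Parrilo–Thomas 2012,
Handbook of Combinatorics Ch. 3 — generic hits only; `lit vsearch` same; galaxy
`odd set constraints|blossom inequalities|matching polytope`, all stars, 18 rows, none on slack-matrix
rank). The statement is elementary linear algebra on a published matrix; it is recorded here because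
the cell's support-based bookkeeping (`supportBasedPsdBound_le_dim`, `supportBased_window_choose_succ`)
quotes the ceiling as `C(n,2) + 1 − n` "= dim + 1" and this file shows that number is the rank of the
odd-cut block itself. Cited to the sources of the objects: [Rothvoss2017, §2] (the matrix),
[Pulleyblank1995, Thm. 5.22] (the matching rank `C(n,2) − n + 1` of `K_n`),
[GouveiaRobinsonThomas2013, Lemma 3.1] (rank of slack matrices), [FawziEtAl2015, Thm. 5.8, §5.2]
(support-based bounds never exceed the rank).

Label: instrument / bookkeeping — no new lower bound on any psd rank; the support-based window for
`S_odd(K_{2m})` stays `[C(m+1,2) − 1, (2m−1)(m−1)]` (a factor `< 4`); nothing on the exponential crux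
(`stmt-PneNP-19878`), nothing on nonnegative rank, no P-vs-NP content. No named fact, no sorry.
-/

noncomputable section

open Finset Matrix

namespace Literature.Barriers.PneNP

open Literature.Combinatorics.Optimization (HasPsdFactorization)
open Literature.Combinatorics.Optimization.PMPolytopeDim (pmVec pmVec_apply rank_pmIncidence
  pmFullSlack rank_pmFullSlack)
open Literature.Combinatorics.SimpleGraph.CycleSpace (Crosses crosses_mk)

namespace OddCutRank

variable {n : ℕ}

/-! ### §1 Linear algebra: an injective left factor does not change the rank -/

/-- `rank (G · X) = rank X` when `w ↦ G w` is injective: the column space of `G · X` is the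
isomorphic image under `G` of the column space of `X`. [folklore] -/
private theorem rank_mul_eq_right_of_injective' {l m k : Type*} [Fintype l] [Fintype m] [Fintype k]
    (G : Matrix l m ℝ) (X : Matrix m k ℝ) (hG : Function.Injective G.mulVec) :
    (G * X).rank = X.rank := by
  unfold Matrix.rank
  rw [Matrix.mulVecLin_mul, LinearMap.range_comp]
  have hG' : Function.Injective G.mulVecLin := by rwa [Matrix.coe_mulVecLin]
  exact (LinearEquiv.finrank_eq (Submodule.equivMapOfInjective G.mulVecLin hG' _)).symm

/-- **`rank (G · X) = rank X` for an injective matrix `G`** (full column rank left factor).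
[cite: GouveiaRobinsonThomas2013, Lemma 3.1 (p07), the rank computation `rank S_P = dim P + 1` factors `S_P` the same way] -/
theorem rank_mul_eq_right_of_injective {l m k : Type*} [Fintype l] [Fintype m] [Fintype k]
    (G : Matrix l m ℝ) (X : Matrix m k ℝ) (hG : Function.Injective G.mulVec) :
    (G * X).rank = X.rank :=
  rank_mul_eq_right_of_injective' G X hG

/-! ### §2 Ordered triangles of `K_n`, their odd sets and their three edges -/

/-- Ordered triples of pairwise distinct vertices of `K_n` — selectors of the triangle rows
`U = {a, b, c}` of the odd-cut slack matrix (each triangle is selected `6` times; harmless for rank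
computations). [folklore] -/
abbrev Tri (n : ℕ) : Type :=
  {t : Fin n × Fin n × Fin n // t.1 ≠ t.2.1 ∧ t.1 ≠ t.2.2 ∧ t.2.1 ≠ t.2.2}

namespace Tri

/-- First vertex. [folklore] -/
def a (t : Tri n) : Fin n := t.1.1
/-- Second vertex. [folklore] -/
def b (t : Tri n) : Fin n := t.1.2.1
/-- Third vertex. [folklore] -/
def c (t : Tri n) : Fin n := t.1.2.2

/-- `a ≠ b`. [folklore] -/
private theorem hab (t : Tri n) : t.a ≠ t.b := t.2.1
/-- `a ≠ c`. [folklore] -/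
private theorem hac (t : Tri n) : t.a ≠ t.c := t.2.2.1
/-- `b ≠ c`. [folklore] -/
private theorem hbc (t : Tri n) : t.b ≠ t.c := t.2.2.2

/-- The vertex set `{a, b, c}` of the triangle. [folklore] -/
def verts (t : Tri n) : Finset (Fin n) := {t.a, t.b, t.c}

/-- `|{a, b, c}| = 3`. [folklore] -/
private theorem card_verts (t : Tri n) : t.verts.card = 3 :=
  Finset.card_eq_three.2 ⟨t.a, t.b, t.c, t.hab, t.hac, t.hbc, rfl⟩

/-- The triangle as an odd vertex set (a row of the odd-cut slack matrix). [cite: Rothvoss2017, §2 (PDF p. 5)] -/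
def toOdd (t : Tri n) : OddSet n :=
  ⟨t.verts, by rw [card_verts]; exact ⟨1, rfl⟩⟩

/-- The edge `{x, y}` of `K_n` for `x ≠ y`. [folklore] -/
def edge (x y : Fin n) (h : x ≠ y) : Edge n := ⟨s(x, y), by rwa [Sym2.mk_isDiag_iff]⟩

/-- The edge `ab` of the triangle. [folklore] -/
def eab (t : Tri n) : Edge n := edge t.a t.b t.hab
/-- The edge `ac` of the triangle. [folklore] -/
def eac (t : Tri n) : Edge n := edge t.a t.c t.hac
/-- The edge `bc` of the triangle. [folklore] -/
def ebc (t : Tri n) : Edge n := edge t.b t.c t.hbc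

end Tri

/-! ### §3 A perfect matching meets a triangle in at most one edge: `S_{UM} = 2 − 2·(χ_M(ab) + χ_M(ac) + χ_M(bc))` -/

/-- `Crosses U e` iff exactly one endpoint of `e` lies in `U`. [folklore] -/
private theorem crosses_iff_cutCount_eq_one (U : Finset (Fin n)) (e : Sym2 (Fin n)) :
    Crosses U e ↔ cutCount U e = 1 := by
  induction e using Sym2.ind with
  | h x y =>
    rw [crosses_mk, cutCount_mk]
    by_cases hx : x ∈ U <;> by_cases hy : y ∈ U <;> simp [hx, hy]

/-- `cutCount U {x,y} = 2` iff both endpoints lie in `U`. [folklore] -/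
private theorem cutCount_mk_eq_two_iff (U : Finset (Fin n)) (x y : Fin n) :
    cutCount U s(x, y) = 2 ↔ x ∈ U ∧ y ∈ U := by
  rw [cutCount_mk]
  by_cases hx : x ∈ U <;> by_cases hy : y ∈ U <;> simp [hx, hy]

/-- A non-loop pair has both endpoints in the triangle `{a,b,c}` iff it is one of `ab, ac, bc`. [folklore] -/
private theorem cutCount_verts_eq_two_iff (t : Tri n) :
    ∀ e : Sym2 (Fin n), ¬e.IsDiag →
      (cutCount t.verts e = 2 ↔ (e = s(t.a, t.b) ∨ e = s(t.a, t.c) ∨ e = s(t.b, t.c))) := by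
  intro e
  induction e using Sym2.ind with
  | h x y =>
    intro hd
    rw [Sym2.mk_isDiag_iff] at hd
    have hab := t.hab
    have hac := t.hac
    have hbc := t.hbc
    rw [cutCount_mk_eq_two_iff]
    simp only [Tri.verts, Finset.mem_insert, Finset.mem_singleton, Sym2.eq_iff]
    constructor
    · rintro ⟨hx | hx | hx, hy | hy | hy⟩ <;> subst hx <;> subst hy <;> simp_all
    · rintro ((⟨hx, hy⟩ | ⟨hx, hy⟩) | (⟨hx, hy⟩ | ⟨hx, hy⟩) | (⟨hx, hy⟩ | ⟨hx, hy⟩)) <;>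
        subst hx <;> subst hy <;> simp

/-- The three pairs `ab, ac, bc` of a triangle are distinct. [folklore] -/
private theorem pairs_ne (t : Tri n) :
    s(t.a, t.b) ≠ s(t.a, t.c) ∧ s(t.a, t.b) ≠ s(t.b, t.c) ∧ s(t.a, t.c) ≠ s(t.b, t.c) := by
  have hab := t.hab
  have hac := t.hac
  have hbc := t.hbc
  refine ⟨?_, ?_, ?_⟩ <;> intro h <;> rw [Sym2.eq_iff] at h
  · rcases h with ⟨-, h⟩ | ⟨h, -⟩
    · exact hbc h
    · exact hac h
  · rcases h with ⟨h, -⟩ | ⟨h, -⟩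
    · exact hab h
    · exact hac h
  · rcases h with ⟨h, -⟩ | ⟨-, h⟩
    · exact hab h
    · exact hbc h.symm

/-- Counting a set against three distinct candidates:
`#{e ∈ s : e = p ∨ e = q ∨ e = r} = 1[p ∈ s] + 1[q ∈ s] + 1[r ∈ s]`. [folklore] -/
private theorem card_filter_three {α : Type*} [DecidableEq α] (s : Finset α) {p q r : α}
    (hpq : p ≠ q) (hpr : p ≠ r) (hqr : q ≠ r) :
    (s.filter fun e => e = p ∨ e = q ∨ e = r).card =
      (if p ∈ s then 1 else 0) + (if q ∈ s then 1 else 0) + (if r ∈ s then 1 else 0) := by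
  have hset : (s.filter fun e => e = p ∨ e = q ∨ e = r) = ({p, q, r} : Finset α).filter (· ∈ s) := by
    ext e
    simp only [Finset.mem_filter, Finset.mem_insert, Finset.mem_singleton]
    tauto
  rw [hset, Finset.card_filter, Finset.sum_insert (by simp [hpq, hpr]),
    Finset.sum_insert (by simp [hqr]), Finset.sum_singleton]
  ring

/-- **`|U| = |δ(U) ∩ M| + 2·|M ∩ E[U]|` for the triangle `U = {a,b,c}`**: the crossing number and the
number of matching edges inside satisfy `cc + 2·#inside = 3`. [cite: Rothvoss2017, §2 (PDF p. 5)] -/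
theorem cc_toOdd_add_two_mul (t : Tri n) (M : PMatch n) :
    cc t.toOdd M + 2 * (M.1.filter fun e => cutCount t.verts e = 2).card = 3 := by
  have h1 := M.2.card_eq_sum_cutCount (Finset.subset_univ t.verts)
  rw [sum_cutCount_eq, Tri.card_verts] at h1
  have hcc : cc t.toOdd M = (M.1.filter fun e => cutCount t.verts e = 1).card := by
    change (M.1.filter (Crosses t.verts)).card = _
    rw [Finset.filter_congr fun e (_ : e ∈ M.1) => crosses_iff_cutCount_eq_one t.verts e]
  omega

/-- The matching edges inside the triangle, counted: `|M ∩ E[{a,b,c}]| = 1[ab ∈ M] + 1[ac ∈ M] + 1[bc ∈ M]`.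
[folklore] -/
private theorem card_inside_eq (t : Tri n) (M : PMatch n) :
    (M.1.filter fun e => cutCount t.verts e = 2).card =
      (if s(t.a, t.b) ∈ M.1 then 1 else 0) + (if s(t.a, t.c) ∈ M.1 then 1 else 0) +
        (if s(t.b, t.c) ∈ M.1 then 1 else 0) := by
  obtain ⟨h1, h2, h3⟩ := pairs_ne t
  rw [Finset.filter_congr fun e (he : e ∈ M.1) => cutCount_verts_eq_two_iff t e (M.2.not_isDiag he)]
  exact card_filter_three M.1 h1 h2 h3

/-- **The triangle rows of Edmonds' odd-cut slack matrix**: for `U = {a, b, c}` and a perfect matching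
`M` of `K_n`, `S_{UM} = |δ(U) ∩ M| − 1 = 2 − 2·(χ_M(ab) + χ_M(ac) + χ_M(bc))` (a perfect matching
contains at most one edge of a triangle; `|δ(U) ∩ M| ∈ {1, 3}`). [cite: Rothvoss2017, §2 (PDF p. 5)] -/
theorem pmOddCutSlack_toOdd (t : Tri n) (M : PMatch n) :
    pmOddCutSlack n t.toOdd M = 2 - 2 * (pmVec n M t.eab + pmVec n M t.eac + pmVec n M t.ebc) := by
  have h := cc_toOdd_add_two_mul t M
  rw [card_inside_eq] at h
  have h' : (cc t.toOdd M : ℝ) + 2 * ((if s(t.a, t.b) ∈ M.1 then 1 else 0) +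
      (if s(t.a, t.c) ∈ M.1 then 1 else 0) + (if s(t.b, t.c) ∈ M.1 then 1 else 0)) = 3 := by
    have := congrArg (Nat.cast : ℕ → ℝ) h
    push_cast at this
    exact this
  rw [pmOddCutSlack_apply]
  have e1 : pmVec n M t.eab = if s(t.a, t.b) ∈ M.1 then 1 else 0 := rfl
  have e2 : pmVec n M t.eac = if s(t.a, t.c) ∈ M.1 then 1 else 0 := rfl
  have e3 : pmVec n M t.ebc = if s(t.b, t.c) ∈ M.1 then 1 else 0 := rfl
  rw [e1, e2, e3]
  linarith

/-! ### §4 A perfect matching of `K_n` has `n/2` edges -/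

/-- `Σ_{e ∈ E(K_n)} χ_M(e) = |M| = n/2` for a perfect matching `M` of `K_n`. [cite: Rothvoss2017, §1 (PDF p. 4)] -/
theorem sum_pmVec (M : PMatch n) : ∑ e : Edge n, pmVec n M e = (n : ℝ) / 2 := by
  classical
  -- `n = Σ_{e ∈ M} cutCount(univ, e) = 2 |M|`
  have hcount : 2 * M.1.card = n := by
    have h := M.2.card_eq_sum_cutCount (Finset.Subset.refl _)
    rw [Finset.card_univ, Fintype.card_fin] at h
    have h2 : ∑ e ∈ M.1, cutCount (Finset.univ : Finset (Fin n)) e = 2 * M.1.card := by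
      rw [Finset.card_eq_sum_ones M.1, Finset.mul_sum]
      refine Finset.sum_congr rfl fun e _ => ?_
      induction e using Sym2.ind with
      | h x y => simp [cutCount_mk]
    omega
  -- `Σ_e χ_M(e) = |M|` (every edge of `M` is a non-loop pair)
  have hsum : ∑ e : Edge n, pmVec n M e = (M.1.card : ℝ) := by
    simp only [pmVec_apply]
    rw [Finset.sum_boole]
    have hset : (Finset.univ.filter fun e : Edge n => e.1 ∈ M.1) =
        M.1.subtype (fun e : Sym2 (Fin n) => ¬e.IsDiag) := by
      ext e
      simp only [Finset.mem_filter, Finset.mem_univ, true_and, Finset.mem_subtype]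
    rw [hset, Finset.card_subtype, Finset.filter_true_of_mem fun e he => M.2.not_isDiag he]
  rw [hsum]
  have h2 : (2 : ℝ) * (M.1.card : ℝ) = n := by exact_mod_cast hcount
  linarith

/-! ### §5 The triangle block factors through the edge–perfect-matching incidence matrix -/

variable (n) in
/-- The coefficient matrix `G` of the triangle rows over the edges:
`G_{(a,b,c), e} = 4/n − 2·(1[e = ab] + 1[e = ac] + 1[e = bc])`. [folklore] -/
def triCoef : Matrix (Tri n) (Edge n) ℝ :=
  Matrix.of fun t e =>
    4 / (n : ℝ) - 2 * (if e = t.eab then 1 else 0) - 2 * (if e = t.eac then 1 else 0) -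
      2 * (if e = t.ebc then 1 else 0)

variable (n) in
/-- The triangle block of the odd-cut slack matrix: rows the ordered triangles, `T_{(a,b,c), M} =
S_{{a,b,c}, M}`. [cite: Rothvoss2017, §2 (PDF p. 5)] -/
def triBlock : Matrix (Tri n) (PMatch n) ℝ :=
  Matrix.of fun t M => pmOddCutSlack n t.toOdd M

variable (n) in
/-- The edge–perfect-matching incidence matrix `X = (χ_M(e))_{e,M}` of `K_n` (the matrix of
`PMPolytopeDim.rank_pmIncidence`). [cite: Pulleyblank1995, §5.1 (p. 206)] -/
def incMat : Matrix (Edge n) (PMatch n) ℝ :=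
  Matrix.of fun (e : Edge n) (M : PMatch n) => pmVec n M e

/-- The triangle block is a row-selection of the odd-cut slack matrix. [cite: Rothvoss2017, §2 (PDF p. 5)] -/
theorem triBlock_eq_submatrix :
    triBlock n = Matrix.submatrix (pmOddCutSlack n : Matrix (OddSet n) (PMatch n) ℝ) Tri.toOdd id :=
  rfl

/-- `G` applied to a vector: `(G w)_{(a,b,c)} = (4/n)·Σ_e w_e − 2·(w(ab) + w(ac) + w(bc))`
(an elementary computation of this file on the triangle rows of [Rothvoss2017]'s matrix).
[cite: Rothvoss2017, §2 (PDF p. 5)] -/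
theorem sum_triCoef_mul (w : Edge n → ℝ) (t : Tri n) :
    ∑ e, triCoef n t e * w e = 4 / (n : ℝ) * ∑ e, w e - 2 * (w t.eab + w t.eac + w t.ebc) := by
  simp only [triCoef, Matrix.of_apply, sub_mul, Finset.sum_sub_distrib, mul_assoc, ite_mul, one_mul,
    zero_mul, ← Finset.mul_sum, Finset.sum_ite_eq', Finset.mem_univ, if_true]
  ring

/-- The same, as `Matrix.mulVec`. [cite: Rothvoss2017, §2 (PDF p. 5)] -/
theorem triCoef_mulVec (w : Edge n → ℝ) (t : Tri n) :
    (triCoef n *ᵥ w) t = 4 / (n : ℝ) * ∑ e, w e - 2 * (w t.eab + w t.eac + w t.ebc) :=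
  sum_triCoef_mul w t

/-- **The factorisation `T = G · X`** of the triangle block through the edge–perfect-matching incidence
matrix (`n ≥ 1`; uses `|M| = n/2`). [cite: Rothvoss2017, §2 (PDF p. 5)] [cite: Pulleyblank1995, §5.1 (p. 206)] -/
theorem triBlock_eq_mul (h1 : 1 ≤ n) : triBlock n = triCoef n * incMat n := by
  ext t M
  rw [Matrix.mul_apply]
  simp only [triBlock, incMat, Matrix.of_apply]
  rw [sum_triCoef_mul (pmVec n M) t, sum_pmVec, pmOddCutSlack_toOdd]
  have hn : (n : ℝ) ≠ 0 := by exact_mod_cast (show n ≠ 0 by omega)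
  field_simp
  ring

/-! ### §6 `G` is injective for `n ≥ 5` -/

/-- The symmetric table of an edge function: `W(x,y) = w({x,y})` for `x ≠ y`, `0` on the diagonal. [folklore] -/
def W (w : Edge n → ℝ) (x y : Fin n) : ℝ :=
  if h : x = y then 0 else w (Tri.edge x y h)

/-- `W` off the diagonal. [folklore] -/
private theorem W_of_ne (w : Edge n → ℝ) {x y : Fin n} (h : x ≠ y) : W w x y = w (Tri.edge x y h) :=
  dif_neg h

/-- `W` is symmetric. [folklore] -/
private theorem W_symm (w : Edge n → ℝ) (x y : Fin n) : W w x y = W w y x := by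
  by_cases h : x = y
  · subst h; rfl
  · rw [W_of_ne w h, W_of_ne w (Ne.symm h)]
    congr 1
    exact Subtype.ext Sym2.eq_swap

/-- Every edge is `{x, y}` for some `x ≠ y`, and `w(e) = W(x,y)`. [folklore] -/
private theorem exists_eq_W (w : Edge n → ℝ) (e : Edge n) :
    ∃ x y : Fin n, x ≠ y ∧ w e = W w x y := by
  obtain ⟨e, he⟩ := e
  induction e using Sym2.ind with
  | h x y =>
    have hxy : x ≠ y := by rwa [Sym2.mk_isDiag_iff] at he
    exact ⟨x, y, hxy, by rw [W_of_ne w hxy]; rfl⟩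

/-- A vertex outside a small set exists. [folklore] -/
private theorem exists_not_mem (S : Finset (Fin n)) (h : S.card < n) : ∃ x : Fin n, x ∉ S := by
  have h' : S.card < (Finset.univ : Finset (Fin n)).card := by
    rwa [Finset.card_univ, Fintype.card_fin]
  obtain ⟨x, -, hx⟩ := Finset.exists_mem_notMem_of_card_lt_card h'
  exact ⟨x, hx⟩

/-- `|E(K_n)| = C(n,2)`. [folklore] -/
private theorem card_edge (n : ℕ) : Fintype.card (Edge n) = n.choose 2 := by
  rw [Sym2.card_subtype_not_diag, Fintype.card_fin]

/-- **`G w = 0 ⇒ w = 0` for `n ≥ 5`.** If all triangle sums `w(ab) + w(ac) + w(bc)` equal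
`(2/n)·Σ_e w_e`, then (four triangles on `{a,b,c,d}`) disjoint edges carry equal weights, (a fifth
vertex) adjacent edges do too, so `w ≡ μ`, and `3μ = (2/n)·C(n,2)·μ = (n−1)μ` gives `μ = 0`.
(Elementary; this file — the kernel computation behind the rank of the triangle rows of
[Rothvoss2017]'s odd-cut slack matrix.) [cite: Rothvoss2017, §2 (PDF p. 5)] -/
theorem eq_zero_of_triCoef_mulVec_eq_zero (h5 : 5 ≤ n) (w : Edge n → ℝ)
    (hw : triCoef n *ᵥ w = 0) : w = 0 := by
  -- all triangle sums are equal to `s`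
  set s : ℝ := 2 / (n : ℝ) * ∑ e, w e with hs
  have htri : ∀ a b c : Fin n, ∀ (hab : a ≠ b) (hac : a ≠ c) (hbc : b ≠ c),
      W w a b + W w a c + W w b c = s := by
    intro a b c hab hac hbc
    have h := congrFun hw ⟨(a, b, c), hab, hac, hbc⟩
    rw [Pi.zero_apply, triCoef_mulVec] at h
    rw [W_of_ne w hab, W_of_ne w hac, W_of_ne w hbc]
    change 4 / (n : ℝ) * ∑ e, w e - 2 * (w (Tri.edge a b hab) + w (Tri.edge a c hac) +
      w (Tri.edge b c hbc)) = 0 at h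
    rw [hs]
    linear_combination (-1 / 2 : ℝ) * h
  -- disjoint edges: `W b c = W a d`
  have hdisj : ∀ a b c d : Fin n, a ≠ b → a ≠ c → a ≠ d → b ≠ c → b ≠ d → c ≠ d →
      W w b c = W w a d := by
    intro a b c d hab hac had hbc hbd hcd
    have h1 := htri a b c hab hac hbc
    have h2 := htri a b d hab had hbd
    have h3 := htri a c d hac had hcd
    have h4 := htri b c d hbc hbd hcd
    linarith
  -- adjacent edges: `W a b = W a c`
  have hstar : ∀ a b c : Fin n, b ≠ a → c ≠ a → W w a b = W w a c := by
    intro a b c hba hca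
    by_cases hbc : b = c
    · rw [hbc]
    obtain ⟨d, hd⟩ := exists_not_mem ({a, b, c} : Finset (Fin n))
      (lt_of_le_of_lt Finset.card_le_three (by omega))
    obtain ⟨e, he⟩ := exists_not_mem ({a, b, c, d} : Finset (Fin n))
      (lt_of_le_of_lt Finset.card_le_four (by omega))
    simp only [Finset.mem_insert, Finset.mem_singleton, not_or] at hd he
    obtain ⟨hda, hdb, hdc⟩ := hd
    obtain ⟨hea, heb, hec, hed⟩ := he
    have h1 : W w a b = W w d e := hdisj d a b e hda hdb (Ne.symm hed) (Ne.symm hba) (Ne.symm hea)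
      (Ne.symm heb)
    have h2 : W w a c = W w d e := hdisj d a c e hda hdc (Ne.symm hed) (Ne.symm hca) (Ne.symm hea)
      (Ne.symm hec)
    rw [h1, h2]
  -- any two edges
  have hall : ∀ x y u v : Fin n, x ≠ y → u ≠ v → W w x y = W w u v := by
    intro x y u v hxy huv
    by_cases hxv : x = v
    · subst hxv
      rw [W_symm w u x]
      exact hstar x y u (Ne.symm hxy) huv
    · calc W w x y = W w x v := hstar x y v (Ne.symm hxy) (Ne.symm hxv)
        _ = W w v x := W_symm w x v
        _ = W w v u := hstar v x u hxv huv
        _ = W w u v := W_symm w v u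
  -- conclude
  funext e₀
  rw [Pi.zero_apply]
  obtain ⟨x, y, hxy, hμ⟩ := exists_eq_W w e₀
  have hconst : ∀ e : Edge n, w e = W w x y := by
    intro e
    obtain ⟨u, v, huv, hu⟩ := exists_eq_W w e
    rw [hu]
    exact hall u v x y huv hxy
  have hsum : ∑ e, w e = (n.choose 2 : ℝ) * W w x y := by
    rw [Finset.sum_congr rfl fun e _ => hconst e, Finset.sum_const, Finset.card_univ, card_edge,
      nsmul_eq_mul]
  obtain ⟨z, hz⟩ := exists_not_mem ({x, y} : Finset (Fin n))
    (lt_of_le_of_lt Finset.card_le_two (by omega))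
  simp only [Finset.mem_insert, Finset.mem_singleton, not_or] at hz
  obtain ⟨hzx, hzy⟩ := hz
  have ht := htri x y z hxy (Ne.symm hzx) (Ne.symm hzy)
  have hxz : W w x z = W w x y := hstar x z y hzx (Ne.symm hxy)
  have hyz : W w y z = W w x y := hall y z x y (Ne.symm hzy) hxy
  rw [hxz, hyz, hs, hsum, Nat.cast_choose_two] at ht
  have hn0 : (n : ℝ) ≠ 0 := by exact_mod_cast (show n ≠ 0 by omega)
  have key : 2 / (n : ℝ) * ((n : ℝ) * ((n : ℝ) - 1) / 2 * W w x y) = ((n : ℝ) - 1) * W w x y := by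
    field_simp
  rw [key] at ht
  have h4 : ((n : ℝ) - 4) * W w x y = 0 := by linarith
  have hn5 : (5 : ℝ) ≤ n := by exact_mod_cast h5
  rcases mul_eq_zero.1 h4 with h | h
  · exfalso; linarith
  · rw [hμ, h]

/-- **`G` is injective on `ℝ^{E(K_n)}` for `n ≥ 5`** (this file's computation). [cite: Rothvoss2017, §2 (PDF p. 5)] -/
theorem triCoef_mulVec_injective (h5 : 5 ≤ n) : Function.Injective (triCoef n).mulVec := by
  intro w₁ w₂ h
  have h0 : triCoef n *ᵥ (w₁ - w₂) = 0 := by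
    rw [Matrix.mulVec_sub, h, sub_self]
  exact sub_eq_zero.1 (eq_zero_of_triCoef_mulVec_eq_zero h5 _ h0)

end OddCutRank

open OddCutRank

/-! ### §7 The rank of the triangle block and of the whole odd-cut slack matrix -/

variable {n : ℕ}

/-- **The triangle rows of Edmonds' odd-cut slack matrix have rank `C(n,2) − n + 1`** (even `n ≥ 6`):
`T = G · X` with `G` injective and `rank X = C(n,2) − n + 1` (the matching rank of `K_n`).
[cite: Pulleyblank1995, §5.3 Thm. 5.22 (p. 210), case `G = K_n`] [cite: Rothvoss2017, §2 (PDF p. 5)] -/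
theorem rank_triBlock (hn : Even n) (h6 : 6 ≤ n) : (triBlock n).rank = n.choose 2 - n + 1 := by
  rw [triBlock_eq_mul (by omega),
    rank_mul_eq_right_of_injective (triCoef n) (incMat n) (triCoef_mulVec_injective (by omega))]
  exact rank_pmIncidence hn (by omega)

/-- `n ≤ C(n,2)` for `n ≥ 3`. [folklore] -/
private theorem le_choose_two (h3 : 3 ≤ n) : n ≤ n.choose 2 := by
  rw [Nat.choose_two_right]
  apply (Nat.le_div_iff_mul_le (by norm_num)).2
  exact Nat.mul_le_mul_left n (by omega)

/-- **The exact rank of Edmonds' odd-cut slack matrix: `rank S_odd(K_n) = C(n,2) − n + 1` for every even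
`n ≥ 6`** (`= dim P_PM(K_n) + 1`; upper bound `PsdFoolingSet.rank_pmOddCutSlack_le`, lower bound the
triangle block `rank_triBlock`). For `n = 4` the matrix is `0` and the statement fails.
[cite: GouveiaRobinsonThomas2013, Lemma 3.1 (p07)] [cite: Pulleyblank1995, §5.3 Thm. 5.22 (p. 210)] [cite: Rothvoss2017, §2 (PDF p. 5)] -/
theorem rank_pmOddCutSlack (hn : Even n) (h6 : 6 ≤ n) :
    Matrix.rank (pmOddCutSlack n : Matrix (OddSet n) (PMatch n) ℝ) = n.choose 2 - n + 1 := by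
  apply le_antisymm
  · have h := PsdFoolingSet.rank_pmOddCutSlack_le (n := n) (by omega)
    have h' := le_choose_two (n := n) (by omega)
    omega
  · rw [← rank_triBlock hn h6, triBlock_eq_submatrix]
    exact Matrix.rank_submatrix_le _ _ _

/-- The `m`-indexed form: `rank S_odd(K_{2m}) = (2m − 1)(m − 1)` for `m ≥ 3`.
[cite: GouveiaRobinsonThomas2013, Lemma 3.1 (p07)] [cite: Rothvoss2017, §2 (PDF p. 5)] -/
theorem rank_pmOddCutSlack_two_mul {m : ℕ} (hm : 3 ≤ m) :
    Matrix.rank (pmOddCutSlack (2 * m) : Matrix (OddSet (2 * m)) (PMatch (2 * m)) ℝ) =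
      (2 * m - 1) * (m - 1) := by
  rw [rank_pmOddCutSlack ⟨m, two_mul m⟩ (by omega), Nat.choose_two_right]
  obtain ⟨k, rfl⟩ : ∃ k, m = k + 3 := ⟨m - 3, by omega⟩
  rw [show 2 * (k + 3) - 1 = 2 * k + 5 by omega, show k + 3 - 1 = k + 2 by omega]
  have h : 2 * (k + 3) * (2 * k + 5) / 2 = (k + 3) * (2 * k + 5) := by
    rw [show 2 * (k + 3) * (2 * k + 5) = (k + 3) * (2 * k + 5) * 2 by ring]
    exact Nat.mul_div_cancel _ (by norm_num)
  have e1 : (k + 3) * (2 * k + 5) = 2 * (k * k) + 11 * k + 15 := by ring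
  have e2 : (2 * k + 5) * (k + 2) = 2 * (k * k) + 9 * k + 10 := by ring
  rw [h, e1, e2]
  omega

/-- **The odd-cut block alone has the full rank of Edmonds' slack matrix**: for even `n ≥ 6`,
`rank S_odd(K_n) = rank S_Edmonds(K_n)` (`= C(n,2) − n + 1`; the edge rows add nothing to the rank).
[cite: GouveiaRobinsonThomas2013, Lemma 3.1 (p07)] [cite: FawziEtAl2015, Cor. 5.9 (p15)] -/
theorem rank_pmOddCutSlack_eq_rank_pmFullSlack (hn : Even n) (h6 : 6 ≤ n) :
    Matrix.rank (pmOddCutSlack n : Matrix (OddSet n) (PMatch n) ℝ) =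
      (Matrix.of fun (j : OddSet n ⊕ Edge n) (M : PMatch n) => pmFullSlack n j M).rank := by
  rw [rank_pmOddCutSlack hn h6, rank_pmFullSlack hn (by omega)]

/-- **Lee–Theis ceiling = rank, exactly.** Every support-based psd-rank lower bound `R` for the odd-cut
slack matrix of `K_n` (`n ≥ 6` even) satisfies `R ≤ rank S_odd(K_n) = C(n,2) − n + 1`: the ceiling
`C(n,2) + 1 − n` of `PsdFoolingSet.supportBasedPsdBound_le_dim` is the rank itself.
[cite: FawziEtAl2015, Thm. 5.8 and §5.2 (p15)] -/
theorem supportBasedPsdBound_le_rank (hn : Even n) (h6 : 6 ≤ n) {R : ℕ}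
    (h : IsSupportBasedPsdBound n R) :
    R ≤ Matrix.rank (pmOddCutSlack n : Matrix (OddSet n) (PMatch n) ℝ) ∧
      Matrix.rank (pmOddCutSlack n : Matrix (OddSet n) (PMatch n) ℝ) = n.choose 2 - n + 1 :=
  ⟨supportBased_le_rank (pmOddCutSlack n : Matrix (OddSet n) (PMatch n) ℝ) h, rank_pmOddCutSlack hn h6⟩

/-- **The support-based window for `S_odd(K_{2m})`, `m ≥ 3`, with its right end identified as the
rank**: fooling-set certificates of size `C(m+1,2) − 1` exist
(`PsdFoolingSet.isSupportBasedPsdBound_choose_succ`), no support-based bound exceeds `rank S_odd(K_{2m})`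
(Lee–Theis), and `rank S_odd(K_{2m}) = (2m−1)(m−1)` exactly.
[cite: FawziEtAl2015, Thm. 5.8 and §5.2 (p15); Thm. 2.10 + Ex. 2.11 (p07)] -/
theorem supportBased_window_rank {m : ℕ} (hm : 3 ≤ m) :
    IsSupportBasedPsdBound (2 * m) ((m + 1).choose 2 - 1) ∧
      (∀ R : ℕ, IsSupportBasedPsdBound (2 * m) R →
        R ≤ Matrix.rank (pmOddCutSlack (2 * m) : Matrix (OddSet (2 * m)) (PMatch (2 * m)) ℝ)) ∧
      Matrix.rank (pmOddCutSlack (2 * m) : Matrix (OddSet (2 * m)) (PMatch (2 * m)) ℝ) =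
        (2 * m - 1) * (m - 1) :=
  ⟨PsdFoolingSet.isSupportBasedPsdBound_choose_succ hm,
    fun _ h => supportBased_le_rank (pmOddCutSlack (2 * m) : Matrix (OddSet (2 * m)) (PMatch (2 * m)) ℝ) h,
    rank_pmOddCutSlack_two_mul hm⟩

end Literature.Barriers.PneNP
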